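import Literature.NumberTheory.LFunctions.DeBruijnNewmanFacts
import Literature.NumberTheory.LFunctions.DeBruijnNewmanUpperBoundProofs
import Literature.NumberTheory.LFunctions.DeBruijnHSimpleZerosProofs
import Literature.NumberTheory.LFunctions.RiemannXiOrderProofs
import Literature.NumberTheory.LFunctions.RiemannXiProofs
import Mathlib.MeasureTheory.Measure.Haar.NormedSpace
import Mathlib.MeasureTheory.Integral.IntegralEqImproper
import HarnessLib

/-!
# `H_t` as a Gaussian average of `ξ` on a horizontal ray, and the Hermite–Biehler reduction of
Ki–Kim–Lee's theorem

Trunk T-ANT (`Literature/NumberTheory/LFunctions`). Everything here is proved (no named facts).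
This is the first file of the in-tree proof of the named fact `Literature.NumberTheory.LFunctions.ki_kim_lee_finite`
(`DeBruijnNewmanFacts.lean`; Ki–Kim–Lee, Adv. Math. 222 (2009), **Thm. 1.3**: for every `t > 0`
all but finitely many zeros of `H_t` are real). The printed proof (op. cit. §4, "saddle point
method", with the authors' Thm. 1.2 = de Bruijn's question) and its effective refinement
Polymath 15, Res. Math. Sci. 6 (2019), **Thm. 1.5 (i)** / §9 both start from the heat-kernel
representation of `H_t` as a Gaussian average of `ξ` (Polymath 15, §4, eq. (30) "(htz)":
`H_t(z) = ∫_ℝ (1/8) ξ((1+iz)/2 + √t v) e^{-v²}/√π dv`). This file proves that representation for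
the tree's `Literature.NumberTheory.LFunctions.deBruijnH` and reduces the reality of the far zeros of `H_t` to a monotonicity
statement for the half-ray transform `𝒜_t(s) = ∫_0^∞ e^{-u²/t} ξ(s+u) du`
(`Literature.NumberTheory.LFunctions.xiHeatRay`), which is established in the companion files `XiHorizontalLogDeriv.lean`,
`XiHeatRayLaplace.lean` (Laplace's method on the ray, where `ξ'/ξ ≈ ½ log(T/2π) + iπ/4`).

## Main results

* `Literature.NumberTheory.LFunctions.exists_norm_riemannXi_le_exp_sq` — `‖ξ(s)‖ ≤ C_ε e^{ε‖s‖²}` for every `ε > 0` (order `1`,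
  from `Literature.NumberTheory.LFunctions.riemannXi_order_le_one_holds`).
* `Literature.NumberTheory.LFunctions.deBruijnH_add_sq_eq_integral` — **forward Gaussian smoothing**:
  `H_{t₀+τ²}(z) = (4π)^{-1/2} ∫_ℝ e^{-r²/4} H_{t₀}(z + iτr) dr` (the imaginary-shift twin of
  `Literature.NumberTheory.LFunctions.deBruijnH_sub_sq_eq_integral`; Rodgers–Tao 2020, §2 eq. (15)).
* `Literature.NumberTheory.LFunctions.deBruijnH_eq_integral_riemannXi` — Polymath 15, eq. (30):
  `H_t(z) = (8√π)^{-1} ∫_ℝ e^{-v²} ξ((1+iz)/2 + √t v) dv` for `t ≥ 0`.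
* `Literature.xiHeatRay t s = ∫_0^∞ e^{-u²/t} ξ(s+u) du` and `Literature.NumberTheory.LFunctions.deBruijnH_eq_xiHeatRay_add`:
  `H_t(z) = (8√(πt))^{-1} (𝒜_t(s) + 𝒜_t(1−s))`, `s = (1+iz)/2`, for `t > 0` (fold `v ↦ −v` with
  `ξ(1−s) = ξ(s)`).
* `Literature.NumberTheory.LFunctions.ki_kim_lee_finite_of_strictMonoOn_xiHeatRay` — **Hermite–Biehler reduction**: if for every
  `0 < t < 1/2` there is `T₀` with `σ ↦ ‖𝒜_t(σ+iT)‖` strictly monotone on `[0,1]` for all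
  `T ≥ T₀`, then `ki_kim_lee_finite` holds (a zero `z = x+iy` gives
  `‖𝒜_t((1−y)/2 + ix/2)‖ = ‖𝒜_t((1+y)/2 + ix/2)‖` by `𝒜_t(s̄) = \overline{𝒜_t(s)}`, and
  `|y| < 1` by `Literature.NumberTheory.LFunctions.Polymath15.abs_im_lt_one_of_zero`; `x < 0` by evenness; `t ≥ 1/2` by `Λ ≤ 1/2`,
  `Literature.NumberTheory.LFunctions.hasOnlyRealZeros_deBruijnH_one_half_holds`).

## References

* H. Ki, Y.-O. Kim, J. Lee, *On the de Bruijn–Newman constant*, Adv. Math. 222 (2009), 281–306,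
  Thm. 1.3, §4.
* D. H. J. Polymath, *Effective approximation of heat flow evolution of the Riemann ξ function, and
  a new upper bound for the de Bruijn–Newman constant*, Res. Math. Sci. 6 (2019) 31
  (arXiv:1904.12438), §4 eq. (30), Thm. 1.5 (i), §9.
* B. Rodgers, T. Tao, *The de Bruijn–Newman constant is non-negative*, Forum Math. Pi 8 (2020),
  §2 eq. (15).
-/

noncomputable section

open Complex Filter Set Topology MeasureTheory

namespace Literature.NumberTheory.LFunctions

/-! ## Sub-Gaussian growth of `ξ` and Gaussian integrability on lines -/

/-- **`ξ` has order `< 2`, quantitatively**: for every `ε > 0` there is `C > 0` with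
`‖ξ(s)‖ ≤ C e^{ε ‖s‖²}` for all `s` (from `‖ξ(s)‖ ≤ C₁ e^{A‖s‖ log(1+‖s‖)}`, Titchmarsh Thm. 2.12,
and `log(1+x) ≤ cx − log c`). [cite: Titchmarsh1986, Thm. 2.12 eq. (2.12.3)] -/
theorem exists_norm_riemannXi_le_exp_sq {ε : ℝ} (hε : 0 < ε) :
    ∃ C : ℝ, 0 < C ∧ ∀ s : ℂ, ‖riemannXi s‖ ≤ C * Real.exp (ε * ‖s‖ ^ 2) := by
  obtain ⟨A, C₁, hA, hC₁, hξ⟩ := riemannXi_order_le_one_holds.nonneg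
  set A' : ℝ := A + 1 with hA'
  have hA'0 : 0 < A' := by linarith
  set c : ℝ := min 1 (ε / (2 * A')) with hc
  have hc0 : 0 < c := lt_min one_pos (by positivity)
  have hc1 : c ≤ 1 := min_le_left _ _
  have hcA : A' * c ≤ ε / 2 := by
    have : c ≤ ε / (2 * A') := min_le_right _ _
    rw [le_div_iff₀ (by positivity)] at this
    linarith
  set B : ℝ := -(A' * Real.log c) with hB
  have hB0 : 0 ≤ B := by
    have : Real.log c ≤ 0 := Real.log_nonpos hc0.le hc1
    rw [hB]; nlinarith
  set K : ℝ := B ^ 2 / (2 * ε) with hK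
  refine ⟨C₁ * Real.exp K + 1, by positivity, fun s ↦ ?_⟩
  set x : ℝ := ‖s‖ with hx
  have hx0 : 0 ≤ x := norm_nonneg _
  have hlog : Real.log (1 + x) ≤ c * x - Real.log c := by
    have h1 := Real.log_le_sub_one_of_pos (show 0 < c * (1 + x) by positivity)
    rw [Real.log_mul hc0.ne' (by positivity)] at h1
    nlinarith
  have hxl : 0 ≤ x * Real.log (1 + x) := mul_nonneg hx0 (Real.log_nonneg (by linarith))
  have hmain : A * x * Real.log (1 + x) ≤ ε * x ^ 2 + K := by
    have h1 : A * x * Real.log (1 + x) ≤ A' * (x * Real.log (1 + x)) := by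
      rw [mul_assoc]; exact mul_le_mul_of_nonneg_right (by linarith) hxl
    have h2 : A' * (x * Real.log (1 + x)) ≤ A' * (x * (c * x - Real.log c)) :=
      mul_le_mul_of_nonneg_left (mul_le_mul_of_nonneg_left hlog hx0) hA'0.le
    have h3 : A' * (x * (c * x - Real.log c)) = A' * c * x ^ 2 + B * x := by rw [hB]; ring
    have h4 : A' * c * x ^ 2 ≤ ε / 2 * x ^ 2 := mul_le_mul_of_nonneg_right hcA (sq_nonneg x)
    have h5 : B * x ≤ ε / 2 * x ^ 2 + K := by
      rw [hK]
      have : 0 ≤ (ε * x - B) ^ 2 / (2 * ε) := by positivity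
      have e : (ε * x - B) ^ 2 / (2 * ε) = ε / 2 * x ^ 2 - B * x + B ^ 2 / (2 * ε) := by
        field_simp; ring
      linarith
    linarith
  calc ‖riemannXi s‖ ≤ C₁ * Real.exp (A * x * Real.log (1 + x)) := hξ s
    _ ≤ C₁ * Real.exp (ε * x ^ 2 + K) := by gcongr
    _ = C₁ * Real.exp K * Real.exp (ε * x ^ 2) := by rw [add_comm, Real.exp_add]; ring
    _ ≤ (C₁ * Real.exp K + 1) * Real.exp (ε * x ^ 2) := by
        gcongr; linarith

/-- **A Gaussian beats `ξ` on every line**: for `b > 0` and complex `s, d`,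
`v ↦ e^{-bv²} ξ(s + dv)` is integrable over `ℝ`. [folklore] -/
theorem integrable_gaussian_mul_riemannXi_line (s d : ℂ) {b : ℝ} (hb : 0 < b) :
    Integrable fun v : ℝ ↦ (Real.exp (-b * v ^ 2) : ℂ) * riemannXi (s + d * v) := by
  set ε : ℝ := b / (4 * (‖d‖ ^ 2 + 1)) with hε
  have hε0 : 0 < ε := by positivity
  obtain ⟨C, hC, hle⟩ := exists_norm_riemannXi_le_exp_sq hε0
  have hεd : 2 * ε * ‖d‖ ^ 2 ≤ b / 2 := by
    rw [hε]
    have h1 : 0 < ‖d‖ ^ 2 + 1 := by positivity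
    rw [show 2 * (b / (4 * (‖d‖ ^ 2 + 1))) * ‖d‖ ^ 2 = b / 2 * (‖d‖ ^ 2 / (‖d‖ ^ 2 + 1)) by
      field_simp; ring]
    have : ‖d‖ ^ 2 / (‖d‖ ^ 2 + 1) ≤ 1 := by rw [div_le_one h1]; linarith
    nlinarith
  have hg : Integrable fun v : ℝ ↦ C * Real.exp (2 * ε * ‖s‖ ^ 2) * Real.exp (-(b / 2) * v ^ 2) :=
    (integrable_exp_neg_mul_sq (by positivity)).const_mul _
  refine hg.mono' ?_ (Eventually.of_forall fun v ↦ ?_)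
  · have : Continuous riemannXi := differentiable_riemannXi.continuous
    exact (by fun_prop : Continuous fun v : ℝ ↦
      (Real.exp (-b * v ^ 2) : ℂ) * riemannXi (s + d * v)).aestronglyMeasurable
  rw [norm_mul, Complex.norm_real, Real.norm_eq_abs, abs_of_pos (Real.exp_pos _)]
  have hn : ‖s + d * v‖ ^ 2 ≤ 2 * ‖s‖ ^ 2 + 2 * ‖d‖ ^ 2 * v ^ 2 := by
    have h1 : ‖s + d * v‖ ≤ ‖s‖ + ‖d‖ * |v| := by
      refine (norm_add_le _ _).trans ?_
      rw [norm_mul, Complex.norm_real, Real.norm_eq_abs]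
    have h2 : 0 ≤ ‖s‖ + ‖d‖ * |v| := by positivity
    calc ‖s + d * v‖ ^ 2 ≤ (‖s‖ + ‖d‖ * |v|) ^ 2 := pow_le_pow_left₀ (norm_nonneg _) h1 2
      _ ≤ 2 * ‖s‖ ^ 2 + 2 * ‖d‖ ^ 2 * v ^ 2 := by
          nlinarith [sq_nonneg (‖s‖ - ‖d‖ * |v|), sq_abs v]
  have hξ := hle (s + d * v)
  calc Real.exp (-b * v ^ 2) * ‖riemannXi (s + d * v)‖
      ≤ Real.exp (-b * v ^ 2) * (C * Real.exp (ε * (2 * ‖s‖ ^ 2 + 2 * ‖d‖ ^ 2 * v ^ 2))) := by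
        gcongr
        exact hξ.trans (by gcongr)
    _ = C * Real.exp (2 * ε * ‖s‖ ^ 2) * Real.exp (-(b / 2) * v ^ 2) *
          Real.exp (-((b / 2 - 2 * ε * ‖d‖ ^ 2) * v ^ 2)) := by
        have : -b * v ^ 2 + ε * (2 * ‖s‖ ^ 2 + 2 * ‖d‖ ^ 2 * v ^ 2) =
            2 * ε * ‖s‖ ^ 2 + -(b / 2) * v ^ 2 + -((b / 2 - 2 * ε * ‖d‖ ^ 2) * v ^ 2) := by ring
        rw [← mul_assoc, mul_comm (Real.exp _) C, mul_assoc C, ← Real.exp_add, this,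
          Real.exp_add, Real.exp_add]; ring
    _ ≤ C * Real.exp (2 * ε * ‖s‖ ^ 2) * Real.exp (-(b / 2) * v ^ 2) * 1 := by
        gcongr
        rw [Real.exp_le_one_iff, neg_nonpos]
        exact mul_nonneg (by linarith) (sq_nonneg v)
    _ = C * Real.exp (2 * ε * ‖s‖ ^ 2) * Real.exp (-(b / 2) * v ^ 2) := mul_one _

/-! ## Forward Gaussian smoothing: `H_{t₀+τ²}` from `H_{t₀}` by imaginary shifts -/

/-- **Forward Gaussian smoothing (heat flow).** For real `t₀, τ` and complex `z`,
`H_{t₀ + τ²}(z) = (4π)^{-1/2} ∫_ℝ e^{-r²/4} H_{t₀}(z + iτr) dr`: the identity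
`e^{τ²u²} e^{izu} = (4π)^{-1/2} ∫ e^{-r²/4} e^{i(z + iτr)u} dr` integrated against de Bruijn's
kernel (Rodgers–Tao 2020, §2 eq. (15), read forwards in time; the imaginary-shift twin of
`Literature.NumberTheory.LFunctions.deBruijnH_sub_sq_eq_integral`). Fubini is justified by `e^{τ|r|u} ≤ e^{r²/8 + 2τ²u²}` and
the finiteness of all Gaussian-exponential moments of the kernel.
[cite: RodgersTaoFMP2020, §2 eq. (15)] -/
theorem deBruijnH_add_sq_eq_integral (t₀ τ : ℝ) (z : ℂ) :
    deBruijnH (t₀ + τ ^ 2) z = (((4 * Real.pi : ℝ) : ℂ) ^ (1 / 2 : ℂ))⁻¹ *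
      ∫ r : ℝ, cexp (-(r : ℂ) ^ 2 / 4) * deBruijnH t₀ (z + I * τ * r) := by
  set C : ℂ := ((4 * Real.pi : ℝ) : ℂ) ^ (1 / 2 : ℂ) with hC
  have hC0 : C ≠ 0 := four_pi_cpow_half_ne_zero
  set K : ℝ → ℂ := deBruijnKernel t₀ with hK
  set K₂ : ℝ → ℂ := deBruijnKernel (t₀ + 2 * τ ^ 2) with hK₂
  have hK₂adm : Literature.Analysis.Complex.DeBruijn1950.IsAdmissible K₂ := isAdmissible_deBruijnKernel _
  -- the two-variable integrand and its integrability
  set G : ℝ → ℝ → ℂ := fun r u ↦ cexp (-(r : ℂ) ^ 2 / 4) * (K u * cexp (I * (z + I * τ * r) * u))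
    with hG
  have hnormK : ∀ u : ℝ, ‖K u‖ * Real.exp (2 * τ ^ 2 * u ^ 2) = ‖K₂ u‖ := by
    intro u
    simp only [hK, hK₂, norm_deBruijnKernel]
    rw [mul_right_comm, ← Real.exp_add]
    congr 2; ring
  have hGi : Integrable (Function.uncurry G) (volume.prod volume) := by
    have hf : Integrable fun r : ℝ ↦ Real.exp (-(1 / 8) * r ^ 2) :=
      integrable_exp_neg_mul_sq (by norm_num)
    have hg : Integrable fun u : ℝ ↦ ‖K₂ u‖ * Real.exp (‖z‖ * |u|) :=
      hK₂adm.integrable_norm_mul_exp _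
    refine (hf.mul_prod hg).mono' ?_ (Eventually.of_forall fun p ↦ ?_)
    · have hc : Continuous (Function.uncurry G) := by
        simp only [hG, Function.uncurry_def]
        have := continuous_deBruijnKernel t₀
        fun_prop
      exact hc.aestronglyMeasurable
    · obtain ⟨r, u⟩ := p
      simp only [Function.uncurry_apply_pair, hG, norm_mul]
      have h1 : ‖cexp (-(r : ℂ) ^ 2 / 4)‖ = Real.exp (-(1 / 4) * r ^ 2) := by
        rw [Complex.norm_exp]
        congr 1
        rw [show -(r : ℂ) ^ 2 / 4 = ((-(1 / 4) * r ^ 2 : ℝ) : ℂ) by push_cast; ring, Complex.ofReal_re]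
      have h2 : ‖cexp (I * (z + I * τ * r) * u)‖ ≤ Real.exp (‖z‖ * |u|) * Real.exp (|τ * r * u|) := by
        have : cexp (I * (z + I * τ * r) * u) = cexp (I * z * u) * cexp (((-(τ * r * u) : ℝ) : ℂ)) := by
          rw [← Complex.exp_add]; push_cast; ring_nf; rw [I_sq]; ring
        rw [this, norm_mul]
        gcongr
        · exact Literature.Analysis.Complex.norm_cexp_I_mul_mul_le z u
        · rw [Complex.norm_exp, Complex.ofReal_re]
          exact Real.exp_le_exp.2 (neg_le_abs _)
      have h3 : Real.exp (|τ * r * u|) ≤ Real.exp ((1 / 8) * r ^ 2) * Real.exp (2 * τ ^ 2 * u ^ 2) := by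
        rw [← Real.exp_add]
        apply Real.exp_le_exp.2
        have : |τ * r * u| = |r| * |τ * u| := by rw [abs_mul, abs_mul, abs_mul]; ring
        rw [this]
        nlinarith [sq_nonneg (|r| / 2 - 2 * |τ * u|), sq_abs r, sq_abs (τ * u), mul_pow τ u 2]
      rw [h1]
      calc Real.exp (-(1 / 4) * r ^ 2) * (‖K u‖ * ‖cexp (I * (z + I * τ * r) * u)‖)
          ≤ Real.exp (-(1 / 4) * r ^ 2) * (‖K u‖ * (Real.exp (‖z‖ * |u|) *
              (Real.exp ((1 / 8) * r ^ 2) * Real.exp (2 * τ ^ 2 * u ^ 2)))) := by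
            gcongr
            exact h2.trans (by gcongr)
        _ = Real.exp (-(1 / 4) * r ^ 2) * Real.exp ((1 / 8) * r ^ 2) *
              ((‖K u‖ * Real.exp (2 * τ ^ 2 * u ^ 2)) * Real.exp (‖z‖ * |u|)) := by ring
        _ = Real.exp (-(1 / 8) * r ^ 2) * (‖K₂ u‖ * Real.exp (‖z‖ * |u|)) := by
            rw [← Real.exp_add, hnormK]; congr 1; congr 1; ring
  -- Fubini
  have hswap := integral_integral_swap hGi
  -- the inner `r`-integral: Fourier transform of the Gaussian
  have hinner : ∀ u : ℝ, ∫ r : ℝ, G r u =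
      C * (K u * cexp ((τ : ℂ) ^ 2 * u ^ 2) * cexp (I * z * u)) := by
    intro u
    have e : (fun r : ℝ ↦ G r u) = fun r : ℝ ↦ (K u * cexp (I * z * u)) *
        (cexp (-(r : ℂ) ^ 2 / 4) * cexp (I * (I * τ * u : ℂ) * r)) := by
      funext r
      simp only [hG]
      rw [show I * (z + I * τ * r) * u = I * z * u + I * (I * τ * u : ℂ) * r by ring, Complex.exp_add]
      ring
    rw [e, integral_const_mul, integral_gaussian_quarter_cexp]
    rw [show -((I * τ * u : ℂ)) ^ 2 = (τ : ℂ) ^ 2 * u ^ 2 by ring_nf; rw [I_sq]; ring]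
    ring
  -- the inner `u`-integral: `2 H_{t₀}(z + iτr)`
  have hinner' : ∀ r : ℝ, ∫ u : ℝ, G r u = cexp (-(r : ℂ) ^ 2 / 4) * (2 * deBruijnH t₀ (z + I * τ * r)) := by
    intro r
    simp only [hG]
    rw [integral_const_mul, ← trigIntegral_deBruijnKernel]
    rfl
  -- the kernel at time `t₀ + τ²`
  have hKt : ∀ u : ℝ, K u * cexp ((τ : ℂ) ^ 2 * u ^ 2) = deBruijnKernel (t₀ + τ ^ 2) u := by
    intro u
    have h := deBruijnKernel_sub t₀ (-τ ^ 2) u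
    rw [show t₀ - -τ ^ 2 = t₀ + τ ^ 2 by ring] at h
    rw [h, hK]
    push_cast
    ring
  -- assemble
  have hlhs : 2 * deBruijnH (t₀ + τ ^ 2) z = C⁻¹ * ∫ u : ℝ, ∫ r : ℝ, G r u := by
    rw [← trigIntegral_deBruijnKernel, Literature.Analysis.Complex.trigIntegral]
    simp_rw [hinner]
    rw [integral_const_mul, ← mul_assoc, inv_mul_cancel₀ hC0, one_mul]
    congr 1
    funext u
    rw [hKt]
  have hrhs : ∫ r : ℝ, ∫ u : ℝ, G r u =
      2 * ∫ r : ℝ, cexp (-(r : ℂ) ^ 2 / 4) * deBruijnH t₀ (z + I * τ * r) := by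
    simp_rw [hinner']
    rw [← integral_const_mul]
    congr 1
    funext r
    ring
  have : 2 * deBruijnH (t₀ + τ ^ 2) z =
      2 * (C⁻¹ * ∫ r : ℝ, cexp (-(r : ℂ) ^ 2 / 4) * deBruijnH t₀ (z + I * τ * r)) := by
    rw [hlhs, ← hswap, hrhs]
    ring
  exact mul_left_cancel₀ two_ne_zero this

/-- **Polymath 15, eq. (30) (htz)**: for `t ≥ 0` and every `z`,
`H_t(z) = (8√π)^{-1} ∫_ℝ e^{-v²} ξ((1+iz)/2 + √t v) dv`
(`deBruijnH_add_sq_eq_integral` at `t₀ = 0`, `τ = √t`, with `H_0(w) = ξ(1/2 + iw/2)/8` and the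
substitution `r = −2v`). [cite: Polymath2019, §4 eq. (30)] -/
theorem deBruijnH_eq_integral_riemannXi {t : ℝ} (ht : 0 ≤ t) (z : ℂ) :
    deBruijnH t z = ((1 / (8 * Real.sqrt Real.pi) : ℝ) : ℂ) *
      ∫ v : ℝ, (Real.exp (-v ^ 2) : ℂ) * riemannXi ((1 + I * z) / 2 + Real.sqrt t * v) := by
  set τ : ℝ := Real.sqrt t with hτ
  have hτ2 : τ ^ 2 = t := Real.sq_sqrt ht
  have h := deBruijnH_add_sq_eq_integral 0 τ z
  rw [zero_add, hτ2] at h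
  rw [h, four_pi_cpow_half_eq]
  -- `H_0(z + iτr) = ξ((1+iz)/2 − τ r/2)/8`
  have hH0 : ∀ r : ℝ, deBruijnH 0 (z + I * τ * r) =
      riemannXi ((1 + I * z) / 2 + τ * (((-(1 / 2 : ℝ)) * r : ℝ) : ℂ)) / 8 := by
    intro r
    rw [deBruijnH_zero_eq_holds]
    congr 2
    push_cast
    ring_nf
    rw [Complex.I_sq]
    ring
  simp_rw [hH0]
  -- substitution `v = -r/2`
  set g : ℝ → ℂ := fun v ↦ (Real.exp (-v ^ 2) : ℂ) * riemannXi ((1 + I * z) / 2 + τ * v) with hg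
  have hsub : (fun r : ℝ ↦ cexp (-(r : ℂ) ^ 2 / 4) *
      (riemannXi ((1 + I * z) / 2 + τ * (((-(1 / 2 : ℝ)) * r : ℝ) : ℂ)) / 8)) =
      fun r : ℝ ↦ (1 / 8 : ℂ) * g ((-(1 / 2 : ℝ)) * r) := by
    funext r
    simp only [hg]
    rw [cexp_neg_sq_quarter_eq]
    have e : -(1 / 4) * r ^ 2 = -((-(1 / 2 : ℝ)) * r) ^ 2 := by ring
    rw [e]
    ring
  rw [hsub, integral_const_mul, Measure.integral_comp_mul_left g]
  have hsq4 : Real.sqrt (4 * Real.pi) = 2 * Real.sqrt Real.pi := by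
    rw [Real.sqrt_mul (by norm_num : (0 : ℝ) ≤ 4), show Real.sqrt 4 = 2 by
      rw [show (4 : ℝ) = 2 ^ 2 by norm_num, Real.sqrt_sq (by norm_num)]]
  have hπ : 0 < Real.sqrt Real.pi := Real.sqrt_pos.2 Real.pi_pos
  have hπ' : (Real.sqrt Real.pi : ℂ) ≠ 0 := by exact_mod_cast hπ.ne'
  rw [show |((-(1 / 2 : ℝ)))⁻¹| = 2 by norm_num, hsq4, Complex.real_smul, ← mul_assoc, ← mul_assoc]
  congr 1
  push_cast
  field_simp

/-! ## The half-ray transform `𝒜_t(s) = ∫_0^∞ e^{-u²/t} ξ(s+u) du` -/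

/-- The Gaussian half-ray transform of `ξ`: `𝒜_t(s) = ∫_0^∞ e^{-u²/t} ξ(s + u) du` (`t > 0`),
the building block of the heat-kernel representation `8√(πt) H_t(z) = 𝒜_t(s) + 𝒜_t(1−s)`,
`s = (1+iz)/2` (Polymath 15, §4 eq. (30), folded by `ξ(1−s) = ξ(s)`).
[cite: Polymath2019, §4 eq. (30)] -/
def xiHeatRay (t : ℝ) (s : ℂ) : ℂ :=
  ∫ u in Ioi (0 : ℝ), (Real.exp (-u ^ 2 / t) : ℂ) * riemannXi (s + u)

/-- The integrand of `𝒜_t(s)` is integrable over `ℝ` (hence over every ray) for `t > 0`. [folklore] -/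
theorem integrable_xiHeatRay_integrand {t : ℝ} (ht : 0 < t) (s : ℂ) :
    Integrable fun u : ℝ ↦ (Real.exp (-u ^ 2 / t) : ℂ) * riemannXi (s + u) := by
  have h := integrable_gaussian_mul_riemannXi_line s 1 (b := 1 / t) (by positivity)
  refine h.congr (Eventually.of_forall fun u ↦ ?_)
  simp only [one_mul]
  congr 2
  · ring

/-- `𝒜_t(s̄) = \overline{𝒜_t(s)}` (`ξ` is real on the real axis). [folklore] -/
theorem xiHeatRay_conj (t : ℝ) (s : ℂ) :
    xiHeatRay t ((starRingEnd ℂ) s) = (starRingEnd ℂ) (xiHeatRay t s) := by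
  rw [xiHeatRay, xiHeatRay, ← integral_conj]
  refine setIntegral_congr_fun measurableSet_Ioi fun u _ ↦ ?_
  simp only [map_mul, Complex.conj_ofReal]
  rw [← riemannXi_conj_holds]
  simp

/-- **Heat-kernel representation of `H_t` on the half-ray** (Polymath 15, §4 eq. (30), folded):
for `t > 0` and every `z`, with `s = (1 + iz)/2`,
`H_t(z) = (8√(πt))^{-1} (𝒜_t(s) + 𝒜_t(1 − s))`. [cite: Polymath2019, §4 eq. (30)] -/
theorem deBruijnH_eq_xiHeatRay_add {t : ℝ} (ht : 0 < t) (z : ℂ) :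
    deBruijnH t z = ((1 / (8 * Real.sqrt (Real.pi * t)) : ℝ) : ℂ) *
      (xiHeatRay t ((1 + I * z) / 2) + xiHeatRay t (1 - (1 + I * z) / 2)) := by
  set s : ℂ := (1 + I * z) / 2 with hs
  set τ : ℝ := Real.sqrt t with hτ
  have hτ0 : 0 < τ := Real.sqrt_pos.2 ht
  have hτ2 : τ ^ 2 = t := Real.sq_sqrt ht.le
  rw [deBruijnH_eq_integral_riemannXi ht.le z]
  have hgi : Integrable (fun v : ℝ ↦ (Real.exp (-v ^ 2) : ℂ) * riemannXi (s + τ * v)) := by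
    have h := integrable_gaussian_mul_riemannXi_line s τ (b := 1) one_pos
    simp only [neg_mul, one_mul] at h
    exact h
  set g : ℝ → ℂ := fun v ↦ (Real.exp (-v ^ 2) : ℂ) * riemannXi (s + τ * v) with hg
  -- fold `ℝ` onto `(0, ∞)`
  have hsplit : ∫ v : ℝ, g v = (∫ v in Ioi (0 : ℝ), g (-v)) + ∫ v in Ioi (0 : ℝ), g v := by
    rw [← intervalIntegral.integral_Iic_add_Ioi hgi.integrableOn hgi.integrableOn,
      integral_comp_neg_Ioi, neg_zero]
  -- `g(-v) = e^{-v²} ξ(1 - s + τ v)`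
  have hneg : ∀ v : ℝ, g (-v) = (Real.exp (-v ^ 2) : ℂ) * riemannXi ((1 - s) + τ * v) := by
    intro v
    simp only [hg]
    rw [← riemannXi_one_sub (1 - s + τ * v)]
    congr 2
    · ring
    · push_cast; ring
  -- the substitution `u = τ v` on `(0, ∞)`
  have hscale : ∀ w : ℂ, ∫ v in Ioi (0 : ℝ), (Real.exp (-v ^ 2) : ℂ) * riemannXi (w + τ * v) =
      (τ⁻¹ : ℝ) • xiHeatRay t w := by
    intro w
    have h := integral_comp_mul_left_Ioi
      (fun u : ℝ ↦ (Real.exp (-u ^ 2 / t) : ℂ) * riemannXi (w + u)) 0 hτ0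
    rw [mul_zero] at h
    rw [xiHeatRay, ← h]
    refine setIntegral_congr_fun measurableSet_Ioi fun v _ ↦ ?_
    congr 2
    · rw [← hτ2]; field_simp
    · push_cast; ring
  have hI1 : ∫ v in Ioi (0 : ℝ), g (-v) = (τ⁻¹ : ℝ) • xiHeatRay t (1 - s) := by
    simp_rw [hneg]; exact hscale (1 - s)
  have hI2 : ∫ v in Ioi (0 : ℝ), g v = (τ⁻¹ : ℝ) • xiHeatRay t s := hscale s
  rw [hsplit, hI1, hI2, ← smul_add, Complex.real_smul, ← mul_assoc, add_comm]
  congr 1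
  have hsqrt : Real.sqrt (Real.pi * t) = Real.sqrt Real.pi * τ := by
    rw [Real.sqrt_mul Real.pi_pos.le]
  rw [hsqrt]
  have hπ : (Real.sqrt Real.pi : ℂ) ≠ 0 := by exact_mod_cast (Real.sqrt_pos.2 Real.pi_pos).ne'
  have hτ' : (τ : ℂ) ≠ 0 := by exact_mod_cast hτ0.ne'
  push_cast
  field_simp

/-! ## Hermite–Biehler reduction -/

/-- **Reality of the far zeros from monotonicity of `|𝒜_t|` (Hermite–Biehler step).** Suppose that
for every `0 < t < 1/2` there is `T₀` such that for all `T ≥ T₀` the function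
`σ ↦ ‖𝒜_t(σ + iT)‖` is strictly monotone on `[0, 1]`. Then `ki_kim_lee_finite` holds: for every
`t > 0` there is `T` such that all zeros `z` of `H_t` with `|Re z| ≥ T` are real. (A zero
`z = x + iy` has `|y| < 1`, and with `s = (1+iz)/2 = (1−y)/2 + ix/2` the representation
`8√(πt) H_t(z) = 𝒜_t(s) + 𝒜_t(1−s)` and `𝒜_t(1−s) = \overline{𝒜_t((1+y)/2 + ix/2)}` give
`‖𝒜_t((1−y)/2 + i x/2)‖ = ‖𝒜_t((1+y)/2 + i x/2)‖`, whence `y = 0` for `x/2 ≥ T₀`; `x < 0` by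
evenness of `H_t`; for `t ≥ 1/2` all zeros are real since `Λ ≤ 1/2`.)
[cite: KiKimLee2009, Thm. 1.3] -/
theorem ki_kim_lee_finite_of_strictMonoOn_xiHeatRay
    (h : ∀ t : ℝ, 0 < t → t < 1 / 2 → ∃ T₀ : ℝ, ∀ T : ℝ, T₀ ≤ T →
      StrictMonoOn (fun σ : ℝ ↦ ‖xiHeatRay t ((σ : ℂ) + T * I)‖) (Icc 0 1)) :
    ki_kim_lee_finite := by
  intro t ht
  by_cases ht2 : t < 1 / 2
  · obtain ⟨T₀, hT₀⟩ := h t ht ht2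
    -- zeros with large positive real part are real
    have key : ∀ z : ℂ, deBruijnH t z = 0 → 2 * T₀ ≤ z.re → z.im = 0 := by
      intro z hz hre
      set x : ℝ := z.re with hx
      set y : ℝ := z.im with hy
      have hy1 : |y| < 1 := Polymath15.abs_im_lt_one_of_zero ht.le hz
      have hmono := hT₀ (x / 2) (by linarith)
      set s : ℂ := (1 + I * z) / 2 with hs
      have hs' : s = (((1 - y) / 2 : ℝ) : ℂ) + (x / 2 : ℝ) * I := by
        rw [hs, ← re_add_im z]
        simp only [← hx, ← hy]
        push_cast
        ring_nf
        rw [Complex.I_sq]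
        ring
      have h1s : 1 - s = (starRingEnd ℂ) ((((1 + y) / 2 : ℝ) : ℂ) + (x / 2 : ℝ) * I) := by
        rw [hs', map_add, Complex.conj_ofReal, map_mul, Complex.conj_ofReal, Complex.conj_I]
        push_cast
        ring
      have hrep := deBruijnH_eq_xiHeatRay_add ht z
      rw [hz] at hrep
      have hc : ((1 / (8 * Real.sqrt (Real.pi * t)) : ℝ) : ℂ) ≠ 0 := by
        have : 0 < Real.sqrt (Real.pi * t) := Real.sqrt_pos.2 (by positivity)
        exact_mod_cast (by positivity : (1 / (8 * Real.sqrt (Real.pi * t)) : ℝ) ≠ 0)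
      have hsum : xiHeatRay t s + xiHeatRay t (1 - s) = 0 := by
        rcases mul_eq_zero.1 hrep.symm with h0 | h0
        · exact absurd h0 hc
        · exact h0
      have hnorm : ‖xiHeatRay t ((((1 - y) / 2 : ℝ) : ℂ) + (x / 2 : ℝ) * I)‖ =
          ‖xiHeatRay t ((((1 + y) / 2 : ℝ) : ℂ) + (x / 2 : ℝ) * I)‖ := by
        rw [← hs', show xiHeatRay t s = -xiHeatRay t (1 - s) from eq_neg_of_add_eq_zero_left hsum,
          norm_neg, h1s, xiHeatRay_conj, Complex.norm_conj]
      have ha : (1 - y) / 2 ∈ Icc (0 : ℝ) 1 := by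
        constructor <;> linarith [(abs_lt.1 hy1).1, (abs_lt.1 hy1).2]
      have hb : (1 + y) / 2 ∈ Icc (0 : ℝ) 1 := by
        constructor <;> linarith [(abs_lt.1 hy1).1, (abs_lt.1 hy1).2]
      have heq := hmono.injOn ha hb hnorm
      linarith
    refine ⟨2 * T₀, fun z hz hre ↦ ?_⟩
    rcases le_or_gt 0 z.re with h0 | h0
    · exact key z hz (by rwa [abs_of_nonneg h0] at hre)
    · have hneg : deBruijnH t (-z) = 0 := by rw [deBruijnH_neg, hz]
      have := key (-z) hneg (by rw [neg_re]; rwa [abs_of_neg h0] at hre)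
      simpa using this
  · -- `t ≥ 1/2`: all zeros are real (`Λ ≤ 1/2`)
    refine ⟨0, fun z hz _ ↦ ?_⟩
    have hreal : HasOnlyRealZeros (deBruijnH t) :=
      HasOnlyRealZeros.mono_deBruijnH_holds (by linarith) hasOnlyRealZeros_deBruijnH_one_half_holds
    exact hreal z hz

end Literature.NumberTheory.LFunctions

end
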